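import Summits.SmoothPoincare4.SmoothPoincare4.Theses.EntropyRung
import Literature.Geometry.Riemannian.GaussianShrinker

/-!
# `PotentialLeThree` minus closedness is false (negative lemma for crux stmt-SmoothPoincare4-10870)

The picked line `cgy-variance-pivot` for crux `EntropyRung.CompactShrinkerGap` closes its transfer
target (the variance budget `∫(R−2)² dV < 2·Vol − 96π²`) along the Cheng–Ribeiro–Zhou sub-line from
the named hypothesis `PotentialLeThree`: for the crux data (closed `M ≃ₕ S⁴`, normalised gradient
shrinker `Ric + Hess f = g/2`, `R + |∇f|² = f`, `∫e^{-f} dV > 32π²√π e^{-3/2}`) one has `f ≤ 3`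
pointwise (`Lines/cgy-variance-pivot.lean`). This file records that CLOSEDNESS IS LOAD-BEARING for
that hypothesis: with `[CompactSpace M]` and `M ≃ₕ S⁴` deleted the statement is refuted by the
Gaussian shrinker `(ℝ⁴, δ, |x|²/4)` — every analytic hypothesis holds (`Θ(ℝ⁴) = 1 > Θ(S³×ℝ)`,
Cao–Hamilton–Ilmanen 2004 §4) while `f(4e₀) = 4 > 3`. (On every non-compact shrinker `f` is proper,
`f ~ d²/4`, so a sup bound on `f` is an intrinsically compact phenomenon; on a compact normalised
shrinker `sup f = sup R`.) Refuter negative lemma (cdisprove gen 3), supports the crux item.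
-/

noncomputable section

namespace Summit.SmoothPoincare4.SmoothPoincare4.Theorems.CompactShrinkerGap.Negative

open scoped Manifold ContDiff ENNReal RealInnerProductSpace ContinuousMap
open MeasureTheory
open Literature.Geometry.Riemannian Literature.Geometry.Lorentzian
open Literature.Geometry.Lorentzian.PseudoRiemannianMetric

/-- The Gaussian potential `|x|²/4` at `4e₀ ∈ ℝ⁴` equals `4`. [folklore] -/
theorem gaussianPotential_single_four :
    gaussianPotential (EuclideanSpace.single (0 : Fin 4) (4 : ℝ)) = 4 := by
  have h : ‖EuclideanSpace.single (0 : Fin 4) (4 : ℝ)‖ = 4 := by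
    rw [EuclideanSpace.single, PiLp.norm_single]
    norm_num
  rw [gaussianPotential, h]
  norm_num

/-- **Closedness is load-bearing for `PotentialLeThree`**: the Gaussian shrinker on `ℝ⁴` satisfies
every analytic hypothesis of the crux, with `∫ e^{-f} = 16π²` above the bar, and `f(4e₀) = 4 > 3`.
[cite: CaoHamiltonIlmanen2004, §4] -/
theorem potentialLeThree_false_without_compactHomotopy :
    ¬ (∀ (M : Type) [TopologicalSpace M] [T2Space M] [SecondCountableTopology M]
        [ChartedSpace (EuclideanSpace ℝ (Fin 4)) M] [IsManifold (𝓡 4) ∞ M] [T3Space M]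
        [MeasurableSpace M] [BorelSpace M],
        ∀ (g : PseudoRiemannianMetric (𝓡 4) ∞ (EuclideanSpace ℝ (Fin 4)) (TangentSpace (𝓡 4) : M → Type _))
          [g.HasLeviCivita] (f : M → ℝ) (hg : g.IsRiemannian), ContMDiff (𝓡 4) 𝓘(ℝ, ℝ) ∞ f →
          (∀ (x : M) (X Y : TangentSpace (𝓡 4) x), g.ricci x X Y + g.hessian f x X Y = (1 / 2 : ℝ) * g.val x X Y) →
          (∀ x : M, g.scalarCurvature x + g.gradSq f x = f x) →
          ENNReal.ofReal (32 * Real.pi ^ 2 * Real.sqrt Real.pi * Real.exp (-(3 : ℝ) / 2)) <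
            ∫⁻ x, ENNReal.ofReal (Real.exp (-f x)) ∂(riemannianMeasure (g.toContMDiffRiemannianMetric hg)) →
          ∀ x : M, f x ≤ 3) := by
  intro h
  have h4 := h EuclideanFour (euclideanMetric EuclideanFour) gaussianPotential isRiemannian_euclideanMetric
    contDiff_gaussianPotential.contMDiff
    (fun x X Y ↦ by
      rw [ricci_euclideanMetric, hessian_gaussianPotential, euclideanMetric_apply]
      simp only [LinearMap.zero_apply, zero_add]
      rw [div_eq_inv_mul, one_div]
      rfl)
    (fun x ↦ by rw [scalarCurvature_euclideanMetric, gradSq_gaussianPotential, zero_add])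
    (by
      change ENNReal.ofReal _ <
        ∫⁻ x, ENNReal.ofReal (Real.exp (-gaussianPotential x)) ∂(riemannianMeasure euclideanFourMetric)
      rw [riemannianMeasure_euclideanFour, lintegral_exp_neg_gaussianPotential]
      exact (ENNReal.ofReal_lt_ofReal_iff (by positivity)).mpr cylinderDensityBound_lt_gaussian)
    (EuclideanSpace.single (0 : Fin 4) (4 : ℝ))
  rw [gaussianPotential_single_four] at h4
  norm_num at h4

end Summit.SmoothPoincare4.SmoothPoincare4.Theorems.CompactShrinkerGap.Negative

end
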